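import Summits.ResolutionOfSingularities.ResolutionOfSingularities.Theorems.WeightedInvariantIota3JEssSmoothLE3OfDescent
import Summits.ResolutionOfSingularities.ResolutionOfSingularities.Theorems.WeightedInvariantIotaFlatTTorusFactorOfTauEssSmooth
import HarnessLib

/-!
# W4.3 door 19897 — P3 rung `KeyRungGrHomLE 3 p` for the named pair `(ι₃ᵗ, J₃ᵗ)`: THE GAP LIST AFTER leafhand-res-weightedinvariant-3
# (hc8 discharged; hc10 and hc11 replaced by their named inputs (desc-τ), `hσ`, (σ-pt), (hpt))

Route `ResolutionOfSingularities/WeightedInvariant`, crux `Theses.WeightedInvariant.HypersurfaceCentreConstruction` (stmt-ResolutionOfSingularities-19897),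
door line `local-engine` (skeleton v3.12 `7a4b52ef4f5779aa`), registered stub `stub_keyRungGrHomLE_three : ∀ p, p.Prime → KeyRungGrHomLE 3 p`.
`keyRungGrHomLE_three_of_residue_at_powers'` (p811583) takes hc10, hc11, hgame, the residue of the dominance word at the power positions, hgr.
This file substitutes the landed reductions hc10 ⟸ (c11τ)≤3 ∧ `hσ` (p811769), (c11τ)≤3 ⟸ (desc-τ) (ascent p811941, glue p812000) and
hc11 ⟸ (desc-τ) ∧ (σ-pt) ∧ (hpt) (p812062), so that the hypothesis list of **`keyRungGrHomLE_three_of_descent`** IS the gap list of the registered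
stub after this hand:
* (desc-τ) descent of tie positions along local formally smooth essentially-of-finite-type homomorphisms of regular local rings into dimension `≤ 3`;
* `hσ` — `σ(T(X), g) ≤ σ(T, g)` at the generic fibre of `T → T[X]`, `dim T ≤ 3`;
* (σ-pt) — `σ(S'_{𝔮'}, f) = σ(S_{𝔮' ∩ S}, f)` at every prime of the target of such a homomorphism, `dim S' ≤ 3`;
* (hpt) — the equal-dimension-three point branch of `JFlatEssSmooth.jFlatT_map` (GAP 1 `jContact` / GAP 2 `jSigmaPt`);
* hgame `CanonicalGameClauseHomLE 3 p iotaFlatT jFlatT`; the residue of the dominance word at the power positions; hgr `IotaUpperSemicontinuousGradedLE 3 p iotaFlatT`.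
[OURS · L1 W4.3 · audit glue; candidates stay candidates; nothing here is a statement of H. Hironaka's 2017 manuscript; AI-written, weaker than
expert review; no claim about resolution of singularities in characteristic `p` beyond the typed statements.]  No definition; no axiom.
-/

noncomputable section

set_option linter.dupNamespace false -- mandated namespace of this single-conjunct summit

open IsLocalRing Literature.AlgebraicGeometry.Resolution Polynomial
open Summit.ResolutionOfSingularities.ResolutionOfSingularities.Theorems

namespace Summit.ResolutionOfSingularities.ResolutionOfSingularities.Cruxes.HypersurfaceCentreConstruction.LocalEngine

open Iota3

/-- **P3 RUNG FOR THE NAMED PAIR MODULO THE GAP LIST AFTER THIS HAND** (see the module docstring for the seven hypotheses). [OURS · audit glue] -/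
theorem keyRungGrHomLE_three_of_descent (p : ℕ)
    (hD : ∀ (T T' : Type) [CommRing T] [IsRegularLocalRing T] [CommRing T'] [IsRegularLocalRing T'] [Algebra T T']
      [IsLocalHom (algebraMap T T')] [Algebra.FormallySmooth T T'] [Algebra.EssFiniteType T T'] (g : T),
      ringKrullDim T' ≤ 3 → IsTiePosition T' (algebraMap T T' g) → IsTiePosition T g)
    (hσ : ∀ (T : Type) [CommRing T] [IsRegularLocalRing T] (g : T)
      [((maximalIdeal T).map (C : T →+* T[X])).IsPrime], ringKrullDim T ≤ 3 →
      iotaSigma (Localization.AtPrime ((maximalIdeal T).map (C : T →+* T[X])))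
        (algebraMap T[X] (Localization.AtPrime ((maximalIdeal T).map (C : T →+* T[X]))) (C g)) ≤ iotaSigma T g)
    (hσpt : ∀ (T T' : Type) [CommRing T] [IsRegularLocalRing T] [CommRing T'] [IsRegularLocalRing T'] [Algebra T T']
      [IsLocalHom (algebraMap T T')] [Algebra.FormallySmooth T T'] [Algebra.EssFiniteType T T'] (g : T) (𝔮' : Ideal T')
      [𝔮'.IsPrime], ringKrullDim T' ≤ 3 →
      iotaSigma (Localization.AtPrime 𝔮') (algebraMap T (Localization.AtPrime 𝔮') g) =
        iotaSigma (Localization.AtPrime (𝔮'.comap (algebraMap T T')))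
          (algebraMap T (Localization.AtPrime (𝔮'.comap (algebraMap T T'))) g))
    (hpt : ∀ (T T' : Type) [CommRing T] [IsRegularLocalRing T] [CommRing T'] [IsRegularLocalRing T'] [Algebra T T']
      [IsLocalHom (algebraMap T T')] [Algebra.FormallySmooth T T'] [Algebra.EssFiniteType T T'] (g : T),
      ringKrullDim T' ≤ 3 → (maximalIdeal T).map (algebraMap T T') = maximalIdeal T' → ringKrullDim T = (3 : ℕ) →
      ∀ m : ℕ, jFlatCoreE T' (algebraMap T T' g) m = (jFlatCoreE T g m).map (algebraMap T T'))
    (hgame : CanonicalGameClauseHomLE 3 p iotaFlatT jFlatT)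
    (hres : ∀ (k₀ : Type) [Field k₀] [CharP k₀ p] [PerfectField k₀]
      (S : Type) [CommRing S] [Algebra k₀ S] [Algebra.EssFiniteType k₀ S] [IsRegularLocalRing S] (f : S),
      ringKrullDim S = (3 : ℕ) → f ≠ 0 → f ∈ (maximalIdeal S) ^ 2 →
      ContactCylinder.topStratumPrime iotaOrdEpsTau S f = maximalIdeal S → iotaEps S f ≠ 1 →
      (∃ ℓ ∈ maximalIdeal S, f ∈ Ideal.span {ℓ ^ (adicOrder f).toNat} ⊔ maximalIdeal S ^ ((adicOrder f).toNat + 1)) →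
      ∀ (a b : ℕ), 0 < b →
      (∀ q' r₁' r₂' : ℕ, AdmissibleTriple q' r₁' r₂' → FlagReaches f (adicOrder f).toNat q' r₁' r₂' → r₁' * b ≤ a * r₂') →
      ∀ (g₁ g₂ g₁' g₂' : S) (q r₁ r₂ : ℕ), AdmissibleTriple q r₁ r₂ → r₁ * b = a * r₂ → q < r₂ → r₂ < r₁ →
        IsTwoFlag g₁ g₂ → IsTwoFlag g₁' g₂' →
        f ∈ flagContactFiltration g₁ g₂ q r₁ r₂ (r₁ * (adicOrder f).toNat) →
        f ∈ flagContactFiltration g₁' g₂' q r₁ r₂ (r₁ * (adicOrder f).toNat) →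
        g₂' ∈ flagContactFiltration g₁ g₂ q r₁ r₂ r₂)
    (hgr : IotaUpperSemicontinuousGradedLE 3 p iotaFlatT) :
    KeyRungGrHomLE 3 p :=
  keyRungGrHomLE_three_of_residue_at_powers' p
    (iotaFlatT_torusFactorMonotoneLE_of_tauEssSmooth
      (fun T T' _ _ _ _ _ _ _ _ g hd => iotaTau_essSmooth_eq_of_descent hD T T' g hd) hσ p)
    (iotaJEssSmoothCompatibleLE_three_of_descent hD hσpt hpt) hgame hres hgr

end Summit.ResolutionOfSingularities.ResolutionOfSingularities.Cruxes.HypersurfaceCentreConstruction.LocalEngine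

end
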